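import Summits.BirchSwinnertonDyer.BirchSwinnertonDyer.Theorems.AlignedTransportAtTwoMainConjectureOfRankZeroBSDAtTwoFineRoadKleinCohomology
import Literature.NumberTheory.EllipticCurves.SubgroupSelmerCocycleCriteriaProofs
import Literature.NumberTheory.EllipticCurves.H1UnramifiedFinite
import HarnessLib

/-!
# Route `AlignedTransportAtTwo`, crux C2 `MainConjectureOfRankZeroBSDAtTwo` (stmt-BirchSwinnertonDyer-22298),
# road (b″): PERFECT DESCENT at `2`, part II — `res : H¹(H, E[2]) → H¹(H ⊓ Gal(K̄/K(E[2])), E[2])` is INJECTIVE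
# for EVERY subgroup `H ≤ Γ_K` (globally and at every place at once)

Cell `bsd-f1-sign2`, WIDTH-5 attach seat `bsd-line-att-p3` (gen 4) on line `birth` of crux C2
(`--supports` stmt-BirchSwinnertonDyer-22298; closes nothing). HONEST FRAMING: THEOREMS ONLY — no definition, no
named fact, no instance, no `sorry`; BSD is NOT proved by any of this. Kernel form of §3 (i)–(ii) of the lead's note
`Cruxes/MainConjectureOfRankZeroBSDAtTwo/PERFECT-DESCENT.md` (att-p2 g4, 2026-08-28), audit items (α), (β): with the
algebra of `…FineRoadKleinCohomology` (`klein_crossedHom_principal`: `H¹(Q̄, V₄) = 0` for every `Q̄ ≤ Aut(V₄) ≅ S₃`).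

## What is proved

* §2 (the tree's Γ-internal model `Literature.NumberTheory.EllipticCurves.subgroupH1 / resOfLe`; any topological
  group `G`, discrete `G`-module `M` with `#M = 4`, `m + m = 0`, subgroups `H₁ ≤ H₂ ≤ G` such that every element of
  `H₂` acting trivially on `M` lies in `H₁`) **`resOfLe_injective_of_klein`**: `res : H¹(H₂, M) → H¹(H₁, M)` is
  INJECTIVE (a kernel class is represented by a cocycle principal on `H₁`,
  `CocycleCriteria.resOfLe_oneCocycleClass_eq_zero_iff`; subtracting that principal cocycle leaves a crossed
  homomorphism on `H₂` vanishing on the kernel of the action). No normality, index, continuity or finiteness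
  hypothesis.
* §3 (elliptic `W` over ANY field `K` with `2 ≠ 0`; `E[2] = W.geomTorsion 2`, `ρ̄ = W.galoisRepTorsion 2`)
  **`resOfLe_geomTorsion_two_injective`**: for all `H₁ ≤ H₂ ≤ Γ_K` with `H₂ ⊓ ker ρ̄ ≤ H₁`, `H¹(H₂, E[2]) →
  H¹(H₁, E[2])` is injective; **`resOfLe_inf_ker_galoisRepTorsion_two_injective`**: for EVERY `H ≤ Γ_K`,
  `H¹(H, E[2]) ↪ H¹(H ⊓ ker ρ̄, E[2])` — globally (`H = Gal(K̄/L)`: `H¹(L, E[2]) ↪ H¹(L(E[2]), E[2]) =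
  Hom_cont(Gal(K̄/L(E[2])), E[2])`) and locally (`H = Gal(K̄/L) ⊓ D_v`) AT ONCE, whatever the image of `ρ̄`
  (`S₃`, `C₃`, `C₂`, trivial); `resOfLe_top_ker_galoisRepTorsion_two_injective` (`H¹(Gal(K(E[2])/K), E[2]) = 0`, the
  first step of an explicit `2`-descent).
* §4 (number field `K`, any `ℤ_p`-extension `κ`, `K_∞ = K̄^{ker κ}`, `F_∞ = K_∞(E[2])`): `H¹(K_∞, E[2]) ↪ H¹(F_∞, E[2])`
  (`resOfLe_kerSubgroup_inf_ker_galoisRepTorsion_two_injective`) and, for every `D ≤ Γ_K`, `H¹(ker κ ⊓ D, E[2]) ↪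
  H¹(ker κ ⊓ D ⊓ ker ρ̄, E[2])` (`resOfLe_kerSubgroup_inf_decomp_two_injective`): `H¹(G_w, E[2]) = 0` for the
  decomposition group `G_w ≤ Gal(F_∞/K_∞) ↪ S₃` of EVERY place `w` — the step of §3 (ii) of the note («`κ` locally
  trivial at `v` ⟺ `φ_κ(D_w) = 0` for all `w ∣ v`») where odd `p` fails.

What is NOT here: the surjective half of inflation–restriction (`H²(Q̄, E[2]) = 0`: every `H`-equivariant
continuous homomorphism `H ⊓ ker ρ̄ → E[2]` is a restriction), the class-field-theoretic identification of
`Hom(Gal(K̄/F_∞)^{ab}, E[2])` with class groups, and Ferrero–Washington — §3 (iii)–(v) of the note.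

References: J.-P. Serre, *Galois Cohomology*, I §2.6 (inflation–restriction), I §5.1; J. H. Silverman, *AEC*,
III.6.4(b), X.1 and X.4 (`2`-descent); R. Greenberg, LNM 1716 (1999) §3 (restriction maps in the cyclotomic tower).
-/

set_option autoImplicit false
-- the Theorems namespace of this sub repeats the summit name by design (D-0017 nested layout)
set_option linter.dupNamespace false

noncomputable section

open scoped Classical

namespace Summit.BirchSwinnertonDyer.BirchSwinnertonDyer.Theorems.AlignedTransportAtTwoFineRoad.PerfectDescent

open Literature.NumberTheory.EllipticCurves Literature.NumberTheory.GaloisRepresentations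

universe u

/-! ## §2 The tree's model: `res : H¹(H₂, M) → H¹(H₁, M)` is injective once `H₁` contains the kernel of the action -/

section Generic

variable {G : Type u} [Group G] [TopologicalSpace G] [IsTopologicalGroup G]
  {M : Type u} [AddCommGroup M] [DistribMulAction G M] [TopologicalSpace M] [DiscreteTopology M]

/-- **Inflation–restriction with a Klein four-group of coefficients: restriction is INJECTIVE.** Let `G` be a
topological group, `M` a discrete `G`-module with four elements and `m + m = 0`, and `H₁ ≤ H₂` subgroups of `G`
such that every element of `H₂` acting trivially on `M` lies in `H₁`. Then `res : H¹(H₂, M) → H¹(H₁, M)` is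
injective: the kernel is `H¹(H₂/H₁·(kernel), M^{…})`-shaped and `H¹(Q̄, M) = 0` for the faithful quotient
`Q̄ ≤ Aut(M) ≅ S₃` (`klein_crossedHom_principal`). No normality, index or continuity hypothesis is needed: a
kernel class has a representative `z` with `z|_{H₁}` principal (`CocycleCriteria.resOfLe_oneCocycleClass_eq_zero_iff`),
and `g ↦ z g - (g • a - a)` is a crossed homomorphism on `H₂` vanishing on the kernel of the action.
[cite: SerreGaloisCohomology1997, I §2.6 (inflation–restriction) and I §5.1] -/
theorem resOfLe_injective_of_klein {H₁ H₂ : Subgroup G} (hle : H₁ ≤ H₂) (h4 : Nat.card M = 4)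
    (h2 : ∀ m : M, m + m = 0) (hker : ∀ g ∈ H₂, (∀ m : M, g • m = m) → g ∈ H₁) :
    Function.Injective (resOfLe M hle) := by
  refine (injective_iff_map_eq_zero _).2 fun c hc ↦ ?_
  obtain ⟨z, rfl⟩ := oneCocycleClass_surjective (discreteTopRep H₂ M) c
  obtain ⟨a, ha⟩ := (CocycleCriteria.resOfLe_oneCocycleClass_eq_zero_iff hle z).mp hc
  -- the crossed homomorphism `ψ = z - ∂a` on `H₂` vanishes on the kernel of the action
  set ψ : H₂ → M := fun g ↦ z.1 g - ((g : G) • a - a) with hψdef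
  have hψ : ∀ g h : H₂, ψ (g * h) = ψ g + g • ψ h := by
    intro g h
    have hz : z.1 (g * h) = z.1 g + (g : G) • z.1 h := by
      have e := z.2 g h
      rw [discreteTopRep_ρ_apply, Subgroup.smul_def] at e
      exact e
    simp only [hψdef, hz, Subgroup.smul_def, Subgroup.coe_mul, mul_smul, smul_sub]
    abel
  have hkerψ : ∀ g : H₂, (∀ m : M, g • m = m) → ψ g = 0 := by
    intro g hg
    have hg1 : (g : G) ∈ H₁ := hker g g.2 fun m ↦ by rw [← Subgroup.smul_def]; exact hg m
    have e : Subgroup.inclusion hle ⟨(g : G), hg1⟩ = g := Subtype.ext rfl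
    have hz := ha ⟨(g : G), hg1⟩
    rw [e] at hz
    simp only [hψdef, hz, sub_self]
  obtain ⟨a', ha'⟩ := klein_crossedHom_principal h4 h2 ψ hψ hkerψ
  rw [oneCocycleClass_eq_zero_iff]
  refine ⟨a + a', fun g ↦ ?_⟩
  have e := ha' g
  simp only [hψdef, Subgroup.smul_def] at e
  rw [discreteTopRep_ρ_apply, Subgroup.smul_def, smul_add, sub_eq_iff_eq_add.mp e]
  abel

/-- Pointwise form: two classes of `H¹(H₂, M)` with the same restriction to `H₁` are equal.
[cite: SerreGaloisCohomology1997, I §2.6 (inflation–restriction)] -/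
theorem eq_of_resOfLe_eq_of_klein {H₁ H₂ : Subgroup G} (hle : H₁ ≤ H₂) (h4 : Nat.card M = 4)
    (h2 : ∀ m : M, m + m = 0) (hker : ∀ g ∈ H₂, (∀ m : M, g • m = m) → g ∈ H₁)
    {c c' : subgroupH1 H₂ M} (h : resOfLe M hle c = resOfLe M hle c') : c = c' :=
  resOfLe_injective_of_klein hle h4 h2 hker h

end Generic

/-! ## §3 Elliptic curves: `H¹(H, E[2]) ↪ H¹(H ⊓ Gal(K̄/K(E[2])), E[2])` for every `H ≤ Γ_K` -/

section TwoTorsion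

open WeierstrassCurve

variable {K : Type} [Field K] (W : WeierstrassCurve K) [W.IsElliptic]

/-- `#E[2] = 4` for an elliptic curve over a field in which `2 ≠ 0` (Silverman AEC III.6.4(b), tree
`card_torsionPoints_eq_sq_holds`). [cite: SilvermanAEC2009, Cor. III.6.4(b)] -/
theorem natCard_geomTorsion_two_of_two_ne_zero (hK : (2 : K) ≠ 0) : Nat.card (W.geomTorsion 2) = 4 := by
  have h2 : ((2 : ℕ) : AlgebraicClosure K) ≠ 0 := by
    rw [Nat.cast_ofNat]
    intro h
    apply hK
    apply (algebraMap K (AlgebraicClosure K)).injective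
    rw [map_ofNat, map_zero]
    exact h
  exact WeierstrassCurve.card_torsionPoints_eq_sq_holds W (AlgebraicClosure K) (n := 2) h2

omit [W.IsElliptic] in
/-- An element of `Γ_K` fixing every point of `E[2]` lies in `ker ρ̄_{E,2} = Gal(K̄/K(E[2]))`. [folklore] -/
theorem mem_ker_galoisRepTorsion_two_of_forall_smul_eq {g : Field.absoluteGaloisGroup K}
    (hg : ∀ P : W.geomTorsion 2, g • P = P) : g ∈ (W.galoisRepTorsion 2).ker := by
  rw [MonoidHom.mem_ker]
  refine Multiplicative.toAdd.injective (AddEquiv.ext fun P ↦ ?_)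
  rw [galoisRepTorsion_apply]
  exact hg P

/-- **Perfect descent at `2`, injective half, for EVERY pair `H₁ ≤ H₂ ≤ Γ_K` with `H₂ ⊓ ker ρ̄_{E,2} ≤ H₁`.** For an
elliptic curve `E = W` over a field `K` with `2 ≠ 0`: the restriction `H¹(H₂, E[2]) → H¹(H₁, E[2])` is injective.
No hypothesis on the image of `ρ̄_{E,2}` (it may be all of `GL₂(𝔽₂) ≅ S₃`, `C₃`, a `C₂`, or trivial): `E[2]` is
cohomologically trivial for every subgroup of `S₃` (`klein_crossedHom_principal`).
[cite: SerreGaloisCohomology1997, I §2.6 (inflation–restriction)] [cite: SilvermanAEC2009, Cor. III.6.4(b) and X.4 (2-descent)] -/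
theorem resOfLe_geomTorsion_two_injective (hK : (2 : K) ≠ 0)
    {H₁ H₂ : Subgroup (Field.absoluteGaloisGroup K)} (hle : H₁ ≤ H₂)
    (hker : H₂ ⊓ (W.galoisRepTorsion 2).ker ≤ H₁) :
    Function.Injective (resOfLe (W.geomTorsion 2) hle) :=
  -- `P + P = 0` on `E[2]` (the tree's `MultTransportAtTwo.add_self_geomTorsion_two` is the case `K = ℚ`)
  resOfLe_injective_of_klein (M := W.geomTorsion 2) hle (natCard_geomTorsion_two_of_two_ne_zero W hK)
    (fun P ↦ Subtype.ext (by
      have h : (P : W.geomPoints) ∈ W.geomTorsion 2 := P.2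
      rw [WeierstrassCurve.mem_geomTorsion_iff, two_zsmul] at h
      exact h))
    fun _ hg hfix ↦ hker ⟨hg, mem_ker_galoisRepTorsion_two_of_forall_smul_eq W hfix⟩

/-- **`H¹(H, E[2]) ↪ H¹(H ⊓ ker ρ̄_{E,2}, E[2])` for EVERY subgroup `H ≤ Γ_K`** (elliptic `E/K`, `2 ≠ 0` in `K`).
With `H = Gal(K̄/L)` this is `H¹(L, E[2]) ↪ H¹(L(E[2]), E[2]) = Hom_cont(Gal(K̄/L(E[2])), E[2])` (GLOBAL perfect
descent to the `2`-division field: `H¹(Gal(L(E[2])/L), E[2]) = 0`); with `H = Gal(K̄/L) ⊓ D_v` for a decomposition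
group `D_v` it is the LOCAL statement `H¹(Gal(L(E[2])_w/L_v), E[2]) = 0` at every place — including the order-`2`
decomposition groups at real and ramified places (PERFECT-DESCENT.md §3 (ii), audit items (α), (β)).
[cite: SerreGaloisCohomology1997, I §2.6 (inflation–restriction)] [cite: SilvermanAEC2009, X.4 (2-descent)] -/
theorem resOfLe_inf_ker_galoisRepTorsion_two_injective (hK : (2 : K) ≠ 0)
    (H : Subgroup (Field.absoluteGaloisGroup K)) :
    Function.Injective
      (resOfLe (W.geomTorsion 2) (inf_le_left : H ⊓ (W.galoisRepTorsion 2).ker ≤ H)) :=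
  resOfLe_geomTorsion_two_injective W hK inf_le_left le_rfl

/-- **`H¹(Gal(K(E[2])/K), E[2]) = 0`, i.e. `H¹(K, E[2]) ↪ H¹(K(E[2]), E[2])`** (the case `H = Γ_K`): the classical
first step of an explicit `2`-descent, valid for every image of `ρ̄_{E,2}`.
[cite: SilvermanAEC2009, X.4 (2-descent) and X.1] -/
theorem resOfLe_top_ker_galoisRepTorsion_two_injective (hK : (2 : K) ≠ 0) :
    Function.Injective
      (resOfLe (W.geomTorsion 2) (le_top : (W.galoisRepTorsion 2).ker ≤ ⊤)) :=
  resOfLe_geomTorsion_two_injective W hK le_top inf_le_right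

end TwoTorsion

/-! ## §4 The cyclotomic tower of road (b″): `H¹(K_∞, E[2]) ↪ H¹(K_∞(E[2]), E[2])`, globally and at every place -/

section Tower

open WeierstrassCurve

variable {K : Type} [Field K] [NumberField K] (W : WeierstrassCurve K) [W.IsElliptic] {p : ℕ} [Fact p.Prime]
  (κ : ZpExtension K p)

/-- **Perfect descent along `F_∞/K_∞`** (`K_∞ = K̄^{ker κ}` any `ℤ_p`-extension, `F_∞ = K_∞(E[2]) = K̄^{ker κ ⊓ ker ρ̄}`):
`res : H¹(K_∞, E[2]) → H¹(F_∞, E[2])` is injective. For `K = ℚ`, `p = 2`, `E` with `S₃`-image this is §3 (ii) of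
PERFECT-DESCENT.md: `H¹(ℚ_Σ/ℚ_∞, E[2]) ↪ Hom_{G_∞}(Gal(ℚ̄/F_∞)^{ab}, E[2])`, `G_∞ = Gal(F_∞/ℚ_∞) ≅ S₃`.
[cite: SerreGaloisCohomology1997, I §2.6 (inflation–restriction)] [cite: GreenbergLNM1716, §3 (restriction maps in the cyclotomic tower)] -/
theorem resOfLe_kerSubgroup_inf_ker_galoisRepTorsion_two_injective :
    Function.Injective (resOfLe (W.geomTorsion 2)
      (inf_le_left : κ.kerSubgroup ⊓ (W.galoisRepTorsion 2).ker ≤ κ.kerSubgroup)) :=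
  resOfLe_inf_ker_galoisRepTorsion_two_injective W two_ne_zero κ.kerSubgroup

/-- **The LOCAL form along `F_∞/K_∞`**: for any subgroup `D ≤ Γ_K` (a decomposition group `D_v`, finite or
infinite place), `res : H¹(ker κ ⊓ D, E[2]) → H¹(ker κ ⊓ D ⊓ ker ρ̄, E[2])` is injective — `H¹(G_w, E[2]) = 0` for the
decomposition group `G_w ≤ Gal(F_∞/K_∞)` of EVERY place, so «`κ` locally trivial at `v`» ⟺ «`φ_κ(D_w) = 0` for all
`w ∣ v`» (PERFECT-DESCENT.md §3 (ii), the step where odd `p` fails).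
[cite: SerreGaloisCohomology1997, I §2.6 (inflation–restriction)] [cite: GreenbergLNM1716, §3 (local restriction maps)] -/
theorem resOfLe_kerSubgroup_inf_decomp_two_injective (D : Subgroup (Field.absoluteGaloisGroup K)) :
    Function.Injective (resOfLe (W.geomTorsion 2)
      (inf_le_left : (κ.kerSubgroup ⊓ D) ⊓ (W.galoisRepTorsion 2).ker ≤ κ.kerSubgroup ⊓ D)) :=
  resOfLe_inf_ker_galoisRepTorsion_two_injective W two_ne_zero (κ.kerSubgroup ⊓ D)

end Tower

end Summit.BirchSwinnertonDyer.BirchSwinnertonDyer.Theorems.AlignedTransportAtTwoFineRoad.PerfectDescent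

end
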